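import Literature.NumberTheory.Automorphic.SpreadProjector
import Literature.NumberTheory.Automorphic.TorusIntegrandThinSupport
import Literature.NumberTheory.Automorphic.ArchWhittakerTranslate
import HarnessLib

/-!
# The spread projector and Whittaker functionals

Topic `NumberTheory/Automorphic`; namespace `Literature.NumberTheory.Automorphic`. Two facts about the
spread projector `E_v` (`SpreadProjector`) and the global Whittaker functional `ℓ` on the Gårding space
of a closed subrepresentation `Π ≤ L²`, used in the construction of the test vector in the proof of
the named fact `JacquetShalika1981_partialPairL_pole_of_eq_conj` in every rank:

* `whittakerFunctional_spreadProjector`: **`E_v` does not change the value of `ℓ`**: for a Gårding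
  vector `y` fixed by `ι_v(K(𝔭^e))`, `E_v y` is a Gårding vector and `ℓ(E_v y) = ℓ(y)` (the average
  is a finite coset sum, `integral_eq_sum_quotient_of_mul_invariant`; each `h ∈ H_v` factors as `u b`
  with `u` unipotent and `b ∈ K(𝔭^e)`, `WhittakerSupport.exists_unipotent_mul_congruence_of_mem_spreadLevelGroup`,
  so `ℓ(Π(ι_v h) y) = χ_v(h) ℓ(y)` and the twist cancels).
* `isSpreadWhittakerAt_of_isotypic`: **the Whittaker coefficient of an `(H_v, χ_v)`-isotypic smoothed
  vector is spread bi-equivariant at `v`** (`IsSpreadWhittakerAt`).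

## References

* H. Jacquet, I. I. Piatetski-Shapiro, J. Shalika, *Conducteur des représentations du groupe
  linéaire*, Math. Ann. 256 (1981), §5.
* D. Bump, *Automorphic Forms and Representations* (1997), §4.4 [Bump1997].
-/

noncomputable section

open MeasureTheory Measure NumberField NumberField.mixedEmbedding IsDedekindDomain Matrix WithZero
open scoped MatrixGroups ComplexConjugate
open Literature.NumberTheory.Automorphic.WhittakerSupport

namespace Literature.NumberTheory.Automorphic

variable {n : ℕ} {K : Type} [Field K] [NumberField K] {v : HeightOneSpectrum (𝓞 K)}
variable {μ : Measure (AdelicGroupData.gl n K).automorphicQuotient} [(AdelicGroupData.gl n K).IsAutomorphicMeasure μ]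

attribute [local instance] adelicBorel borelSpace_adelic locallyCompactSpace_adelic secondCountableTopology_gl_adelic
  glAdeleBorel borelSpace_glAdele

variable {W : ContRepresentation.ClosedSubrep ((AdelicGroupData.gl n K).rightRegular μ)}
  {t : Fin n → (v.adicCompletion K)ˣ} {M : ℤ}

/-! ### Equivariance of `ℓ(Π(ι_v ·) y)` under `H_v` -/

/-- **`ℓ(Π(ι_v(h)) y) = χ_v(h) ℓ(y)`** for `h ∈ H_v` and `y` a Gårding vector fixed by `ι_v(K(𝔭^e))`
(`M ≥ 1`, `0 ≤ e ≤ M`, ratios `|t_i/t_j| ≤ exp(-e)` for `j < i`, `ψ_v(t_i t_{i+1}⁻¹ 𝔭^M) = 1`):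
`h = u b`, `b` fixes `y`, and `u` acts through `ψ_N`. [folklore] -/
theorem whittakerFunctional_toContRep_ofLocal (ν₀ : Measure ↥(adelicUnipotent n K)) [IsHaarMeasure ν₀]
    {e : ℤ} (hM : 1 ≤ M) (he : 0 ≤ e) (heM : e ≤ M)
    (hψ : ∀ i j : Fin n, (i : ℕ) + 1 = j → ∀ x : v.adicCompletion K, Valued.v x ≤ exp (-M) →
      (adeleAddChar K).adicComponent v ((t i : v.adicCompletion K) * (t j : v.adicCompletion K)⁻¹ * x) = 1)
    (hshrink : ∀ i j : Fin n, j < i → Valued.v ((t i : v.adicCompletion K) * (t j : v.adicCompletion K)⁻¹) ≤ exp (-e))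
    {y : W.toSubmodule} (hy : y ∈ gardingSpace W)
    (hfix : ∀ k ∈ valuedCongruenceSubgroup (Fin n) (exp (-e)), W.toContRep (GLn.ofLocal n K v k) y = y)
    {h : GL (Fin n) (v.adicCompletion K)} (hh : h ∈ spreadLevelGroup t M) :
    whittakerFunctional ν₀ (continuous_adeleAddChar K) (ContRepresentation.Equiv.refl W.toContRep)
        ⟨W.toContRep (GLn.ofLocal n K v h) y, toContRep_mem_gardingSpace _ hy⟩ =
      spreadChar v h * whittakerFunctional ν₀ (continuous_adeleAddChar K) (ContRepresentation.Equiv.refl W.toContRep)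
        ⟨y, hy⟩ := by
  obtain ⟨u, hu, b, hb, rfl, hchar⟩ :=
    exists_unipotent_mul_congruence_of_mem_spreadLevelGroup ((adeleAddChar K).adicComponent v) hM he heM hψ hshrink hh
  have hℓW := isContWhittakerFunctional_whittakerFunctional (W := W) ν₀ (continuous_adeleAddChar K)
    (isGlobalAddChar_adeleAddChar K) (ContRepresentation.Equiv.refl W.toContRep)
  have h1 : W.toContRep (GLn.ofLocal n K v (u * b)) y = W.toContRep (GLn.ofLocal n K v u) y := by
    rw [map_mul, ClosedSubrep.toContRep_mul_apply, hfix b hb]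
  have h2 : (⟨W.toContRep (GLn.ofLocal n K v (u * b)) y, toContRep_mem_gardingSpace _ hy⟩ : gardingSpace W) =
      ⟨W.toContRep ((⟨GLn.ofLocal n K v u, ofLocal_mem_adelicUnipotent hu⟩ : ↥(adelicUnipotent n K)) :
          GL (Fin n) (AdeleRing (𝓞 K) K)) y, toContRep_mem_gardingSpace _ hy⟩ :=
    Subtype.ext h1
  rw [h2, hℓW.map_unipotent ⟨GLn.ofLocal n K v u, ofLocal_mem_adelicUnipotent hu⟩ ⟨y, hy⟩,
    whittakerCharFun_ofLocal (adeleAddChar K) ⟨u, hu⟩, ← hchar, spreadChar_apply]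

/-! ### `E_v` preserves the value of `ℓ` -/

variable [MeasurableSpace (GL (Fin n) (v.adicCompletion K))] [BorelSpace (GL (Fin n) (v.adicCompletion K))]

/-- **`E_v y` is a finite combination of translates of `y`**: with `H₀ = H_v ∩ K(𝔭^e)` (open in the
compact `H_v`), on which `χ_v` is trivial and which fixes `y`,
`E_v y = Σ_{q ∈ H_v/H₀} m_q χ̄_v(h_q) Π(ι_v(h_q)) y`. [folklore] -/
theorem spreadProjector_eq_sum
    (hψ : ∀ i j : Fin n, (i : ℕ) + 1 = j → ∀ x : v.adicCompletion K, Valued.v x ≤ exp (-M) →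
      (adeleAddChar K).adicComponent v ((t i : v.adicCompletion K) * (t j : v.adicCompletion K)⁻¹ * x) = 1)
    {e : ℤ} (hψe : ∀ x : v.adicCompletion K, Valued.v x ≤ exp (-e) → (adeleAddChar K).adicComponent v x = 1)
    {y : W.toSubmodule}
    (hfix : ∀ k ∈ valuedCongruenceSubgroup (Fin n) (exp (-e)), W.toContRep (GLn.ofLocal n K v k) y = y) :
    ∃ (ι : Type) (_ : Fintype ι) (m : ι → ℝ) (r : ι → GL (Fin n) (v.adicCompletion K)),
      (∀ i, r i ∈ spreadLevelGroup t M) ∧ (∑ i, m i = 1) ∧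
      spreadProjector v W t M y = ∑ i, ((m i : ℝ) : ℂ) • ((conj (spreadChar v (r i))) • W.toContRep (GLn.ofLocal n K v (r i)) y) := by
  set G₀ := ↥(spreadLevelGroup t M) with hG₀
  have hcpt := isCompact_spreadLevelGroup v t M
  haveI : CompactSpace G₀ := compactSpace_subgroup _ hcpt
  set H₀ : Subgroup G₀ := (valuedCongruenceSubgroup (Fin n) (exp (-e))).subgroupOf (spreadLevelGroup t M) with hH₀
  have hH₀o : IsOpen (H₀ : Set G₀) := (isOpen_valuedCongruenceSubgroup n K v coe_ne_zero).preimage continuous_subtype_val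
  haveI : Finite (G₀ ⧸ H₀) := Subgroup.quotient_finite_of_isOpen H₀ hH₀o
  haveI : Fintype (G₀ ⧸ H₀) := Fintype.ofFinite _
  have hTD := isTwistData_spread v W hψ
  set F : G₀ → W.toSubmodule := fun j => (conj (spreadChar v (j : GL (Fin n) (v.adicCompletion K)))) •
    W.toContRep (GLn.ofLocal n K v (j : GL (Fin n) (v.adicCompletion K))) y with hF
  have hFinv : ∀ g : G₀, ∀ h ∈ H₀, F (g * h) = F g := by
    intro g h hh
    have hh' : (h : GL (Fin n) (v.adicCompletion K)) ∈ valuedCongruenceSubgroup (Fin n) (exp (-e)) :=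
      Subgroup.mem_subgroupOf.1 hh
    have hχ : spreadChar v (h : GL (Fin n) (v.adicCompletion K)) = 1 := by
      rw [spreadChar_apply,
        addChar_sdiagMat_eq_one_of_mem_valuedCongruenceSubgroup ((adeleAddChar K).adicComponent v) hψe hh',
        Circle.coe_one]
    have e1 : ((g * h : G₀) : GL (Fin n) (v.adicCompletion K)) =
        (g : GL (Fin n) (v.adicCompletion K)) * (h : GL (Fin n) (v.adicCompletion K)) := rfl
    simp only [hF]
    rw [e1, spreadChar_mul v hψ g.2 h.2, hχ, mul_one, map_mul, ClosedSubrep.toContRep_mul_apply, hfix _ hh']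
  have hsum := integral_eq_sum_quotient_of_mul_invariant (subgroupHaar (spreadLevelGroup t M) hcpt) H₀ hH₀o
    (F := F) (hTD.integrable_integrand y) hFinv
  refine ⟨G₀ ⧸ H₀, inferInstance,
    fun q => ((subgroupHaar (spreadLevelGroup t M) hcpt) ((QuotientGroup.mk : G₀ → G₀ ⧸ H₀) ⁻¹' {q})).toReal,
    fun q => ((q.out : G₀) : GL (Fin n) (v.adicCompletion K)), fun q => (q.out : G₀).2, ?_, ?_⟩
  · rw [sum_measureReal_preimage_mk _ H₀ hH₀o, measure_univ, ENNReal.toReal_one]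
  · rw [spreadProjector_def]
    change ∫ j, F j ∂(subgroupHaar (spreadLevelGroup t M) hcpt) = _
    rw [hsum]
    refine Finset.sum_congr rfl fun q _ => ?_
    simp only [hF]
    rw [Complex.coe_smul]
    rfl

/-- **`E_v` preserves the Gårding space and the value of the Whittaker functional**: for a Gårding
vector `y` fixed by `ι_v(K(𝔭^e))` (`M ≥ 1`, `0 ≤ e ≤ M`, `ψ_v(𝔭^e) = 1`, ratios `|t_i/t_j| ≤ exp(-e)`
for `j < i`, `ψ_v(t_i t_{i+1}⁻¹ 𝔭^M) = 1`), `E_v y` is a Gårding vector and `ℓ(E_v y) = ℓ(y)`.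
[folklore] -/
theorem whittakerFunctional_spreadProjector (ν₀ : Measure ↥(adelicUnipotent n K)) [IsHaarMeasure ν₀]
    {e : ℤ} (hM : 1 ≤ M) (he : 0 ≤ e) (heM : e ≤ M)
    (hψ : ∀ i j : Fin n, (i : ℕ) + 1 = j → ∀ x : v.adicCompletion K, Valued.v x ≤ exp (-M) →
      (adeleAddChar K).adicComponent v ((t i : v.adicCompletion K) * (t j : v.adicCompletion K)⁻¹ * x) = 1)
    (hψe : ∀ x : v.adicCompletion K, Valued.v x ≤ exp (-e) → (adeleAddChar K).adicComponent v x = 1)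
    (hshrink : ∀ i j : Fin n, j < i → Valued.v ((t i : v.adicCompletion K) * (t j : v.adicCompletion K)⁻¹) ≤ exp (-e))
    {y : W.toSubmodule} (hy : y ∈ gardingSpace W)
    (hfix : ∀ k ∈ valuedCongruenceSubgroup (Fin n) (exp (-e)), W.toContRep (GLn.ofLocal n K v k) y = y) :
    ∃ hE : spreadProjector v W t M y ∈ gardingSpace W,
      whittakerFunctional ν₀ (continuous_adeleAddChar K) (ContRepresentation.Equiv.refl W.toContRep)
          ⟨spreadProjector v W t M y, hE⟩ =
        whittakerFunctional ν₀ (continuous_adeleAddChar K) (ContRepresentation.Equiv.refl W.toContRep) ⟨y, hy⟩ := by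
  obtain ⟨ι, _, m, r, hr, hm, hE⟩ := spreadProjector_eq_sum hψ hψe hfix (y := y)
  set ℓ := whittakerFunctional ν₀ (continuous_adeleAddChar K) (ContRepresentation.Equiv.refl W.toContRep) with hℓ
  have hmem : ∀ i, W.toContRep (GLn.ofLocal n K v (r i)) y ∈ gardingSpace W := fun i => toContRep_mem_gardingSpace _ hy
  have hEmem : spreadProjector v W t M y ∈ gardingSpace W := by
    rw [hE]
    exact Submodule.sum_mem _ fun i _ => Submodule.smul_mem _ _ (Submodule.smul_mem _ _ (hmem i))
  refine ⟨hEmem, ?_⟩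
  have hvec : (⟨spreadProjector v W t M y, hEmem⟩ : gardingSpace W) =
      ∑ i, ((m i : ℝ) : ℂ) • ((conj (spreadChar v (r i))) • (⟨W.toContRep (GLn.ofLocal n K v (r i)) y, hmem i⟩ : gardingSpace W)) := by
    apply Subtype.ext
    rw [Submodule.coe_sum]
    simp only [Submodule.coe_smul]
    exact hE
  rw [hvec, _root_.map_sum]
  have hTD := isTwistData_spread v W hψ
  calc ∑ i, ℓ (((m i : ℝ) : ℂ) • ((conj (spreadChar v (r i))) •
          (⟨W.toContRep (GLn.ofLocal n K v (r i)) y, hmem i⟩ : gardingSpace W)))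
      = ∑ i, ((m i : ℝ) : ℂ) * ℓ ⟨y, hy⟩ := by
        refine Finset.sum_congr rfl fun i _ => ?_
        rw [map_smul, map_smul, smul_eq_mul, smul_eq_mul,
          whittakerFunctional_toContRep_ofLocal ν₀ hM he heM hψ hshrink hy hfix (hr i),
          ← mul_assoc (conj (spreadChar v (r i))), hTD.conj_char_mul_char (hr i), one_mul]
    _ = ℓ ⟨y, hy⟩ := by
        rw [← Finset.sum_mul, ← Complex.ofReal_sum, hm, Complex.ofReal_one, one_mul]

/-! ### Isotypic smoothed vectors have spread bi-equivariant Whittaker coefficients -/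

omit [MeasurableSpace (GL (Fin n) (v.adicCompletion K))] [BorelSpace (GL (Fin n) (v.adicCompletion K))] in
/-- **The Whittaker coefficient of an `(H_v, χ_v)`-isotypic smoothed vector is spread bi-equivariant at
`v`** (`IsSpreadWhittakerAt`): `W(g ι_v(h)) = ℓ(Π(g) Π(ι_v h) u) = χ_v(h) W(g)`, the unipotents of
the band lie in `H_v` with `χ_v = ψ_{v,N}`, and the `d`-twisted congruence elements lie in `H_v` with
`χ_v = 1`. [folklore] -/
theorem isSpreadWhittakerAt_of_isotypic (ν₀ : Measure ↥(adelicUnipotent n K)) [IsHaarMeasure ν₀] (hM : 0 ≤ M)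
    (hψ : ∀ i j : Fin n, (i : ℕ) + 1 = j → ∀ x : v.adicCompletion K, Valued.v x ≤ exp (-M) →
      (adeleAddChar K).adicComponent v ((t i : v.adicCompletion K) * (t j : v.adicCompletion K)⁻¹ * x) = 1)
    {η : GL (Fin n) (AdeleRing (𝓞 K) K) → ℝ} (hη : IsTestFunctionGL n K η) (f : W.toSubmodule)
    (hiso : ∀ h ∈ spreadLevelGroup t M,
      W.toContRep (GLn.ofLocal n K v h) (smoothedVector W η f) = spreadChar v h • smoothedVector W η f) :
    IsSpreadWhittakerAt v (adeleAddChar K) t M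
      (whittakerCoeff ν₀ (unipotentTateDomain n K) (adeleAddChar K)
        (invQuot (AdelicGroupData.gl n K) (smoothedForm η (f : (AdelicGroupData.gl n K).L2 μ)))) := by
  set u := smoothedVector W η f with hu
  have huG : u ∈ gardingSpace W := smoothedVector_mem_gardingSpace hη f
  have hrep := hasContRep_smoothedVector W hη.continuous hη.hasCompactSupport f
  -- `W(g ι(h)) = χ(h) W(g)` for `h ∈ H_v`
  have key : ∀ h ∈ spreadLevelGroup t M, ∀ g : GL (Fin n) (AdeleRing (𝓞 K) K),
      whittakerCoeff ν₀ (unipotentTateDomain n K) (adeleAddChar K)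
          (invQuot (AdelicGroupData.gl n K) (smoothedForm η (f : (AdelicGroupData.gl n K).L2 μ)))
          (g * GLn.ofLocal n K v h) =
        spreadChar v h * whittakerCoeff ν₀ (unipotentTateDomain n K) (adeleAddChar K)
          (invQuot (AdelicGroupData.gl n K) (smoothedForm η (f : (AdelicGroupData.gl n K).L2 μ))) g := by
    intro h hh g
    rw [← whittakerFunctional_toContRep_eq_whittakerCoeff ν₀ (continuous_adeleAddChar K) huG hrep,
      ← whittakerFunctional_toContRep_eq_whittakerCoeff ν₀ (continuous_adeleAddChar K) huG hrep]
    have h1 : (⟨W.toContRep (g * GLn.ofLocal n K v h) u, toContRep_mem_gardingSpace _ huG⟩ : gardingSpace W) =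
        spreadChar v h • ⟨W.toContRep g u, toContRep_mem_gardingSpace _ huG⟩ := by
      apply Subtype.ext
      change W.toContRep (g * GLn.ofLocal n K v h) u = spreadChar v h • W.toContRep g u
      rw [ClosedSubrep.toContRep_mul_apply, hiso h hh, map_smul]
    rw [h1, map_smul, smul_eq_mul]
  refine ⟨fun u' hu' hbd g => ?_, fun κ hκ hκ' g => ?_⟩
  · rw [key u' (mem_spreadLevelGroup_of_mem_upperUnitriangular hu' hbd) g, ← spreadChar_unipotent v ⟨u', hu'⟩]
  · rw [key κ (mem_spreadLevelGroup_of_level hM hκ hκ') g, spreadChar_apply,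
      addChar_sdiagMat_eq_one_of_level ((adeleAddChar K).adicComponent v) hψ hκ, Circle.coe_one, one_mul]

end Literature.NumberTheory.Automorphic
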